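import Literature.NumberTheory.EllipticCurves.Disegni2020.PAdicBSDRankOneNonsplit
import Literature.NumberTheory.EllipticCurves.PAdicBSD
import HarnessLib

/-!
# Disegni 2020, Theorem 4 (second clause, exact form) at a SPLIT multiplicative prime `p ≥ 5`: the
# rank-one exceptional-zero `p`-adic Birch–Swinnerton-Dyer leading-term identity, for IRREDUCIBLE `E[p]`
# and a second multiplicative prime

Topic `Literature/NumberTheory/EllipticCurves` (cluster `Disegni2020`); companion of
`PAdicBSDRankOneNonsplit.lean` (the non-split clause, image-agnostic). ONE named fact (D-0014 style,
nothing asserted) + two proved projections. HONEST FRAMING (BSD rank-`≤ 1` residual cell `b2b-bsdres`,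
lane CLASS-CLOSURE, seat `cc-typer-6`; a POINTER for the X11b = N8 owners, not a booking): the cell
deletes the COMBINATION-SHAPED residual classes of the rank-`≤ 1` BSD formula STRICTLY from published
theorems and TYPES the remainder; this is not "finishing BSD". This clause does NOT serve the reducible
class X2 (its printed proof inherits Venerucci's irreducibility hypothesis, made EXPLICIT below); it
serves the irreducible multiplicative rank-one class X11b at a SPLIT prime `p ≥ 5` with a ramified second
multiplicative prime (where Skinner 2016 Thm. A gives the main conjecture).

## The source, as printed (read 2026-08-21; `paper:arxiv-1609.02528` = the accepted text)

D. Disegni, *On the `p`-adic Birch and Swinnerton-Dyer conjecture for elliptic curves over number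
fields*, Kyoto J. Math. 60 (2020) 473–510 [`Disegni2020`], Thm. 4 (§3.2, p0011), second clause: "If
`r = 1` and the reduction of `E` at `p` is split multiplicative, suppose that `p ≥ 5`. Then [(BSD_p)]
holds up to a nonzero rational number; if moreover there is at least another prime `m ≠ p` of
multiplicative reduction for `E`, then [(BSD_p)] holds exactly, that is
`d² L_p(E, 𝟙) = 𝓛_p(E) · R^norm(E) · L'_alg(E,1)` in `Γ_ℚ^{⊗2} ⊗ ℚ`", where (§3.1, p0011)
`L*_alg(A,1) := L^{(r)}(A,1)/(r! |D_K|^{-1/2} Ω_A R_NT(A))` (Néron period, Néron–Tate regulator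
"accounting for `|A(K)_tors|²`"), `𝓛_p(E) = log_p(q_E)/ord_p(q_E)` (the `𝓛`-invariant, §1.2.1 p0006),
`R^norm` the discriminant of the NORM-ADAPTED (Schneider) `p`-adic height `h^norm` on `E(ℚ)`
(accounting for torsion), and (BSD_p) includes "`L_p(E)` vanishes at `𝟙` to order at least
`r̃ = r + |S_p^exc| = 2`"; Prop. 3.2 (p0011, "compatibility", "already given in [MTT]") identifies this
with the Mazur–Tate–Teitelbaum form of the conjecture. PROOF (§3.2.2, p0012–p0013): "The result is
proven by Venerucci [Invent. Math. 203 (2016), Thm. D] up to a rational constant. We remove the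
ambiguity assuming … a prime `m ≠ p` of multiplicative reduction": Prop. 3.5 "(Venerucci)" on the
Shimura curve `X^{mp}_0(N/mp)` (optimal quotient "can always be achieved up to replacing `E` by an
isogenous curve"; (BSD_p) is isogeny-invariant, Prop. 3.3), Prop. 3.6 (Takahashi / Ribet–Takahashi
degree comparison), Lemma 3.3 (invariance under `E ↦ E_K`). INHERITED HYPOTHESES, NOT restated in
Thm. 4 but standing in the imported source (`Venerucci2015`, p. 2 of arXiv:1407.1913 = Invent. Math.
203 (2016) §1): "conductor `Np`, with `p > 3` a prime of split multiplicative reduction"; "Assume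
throughout this paper that the `p`-torsion subgroup `A_p` of `A(ℚ̄)` is an IRREDUCIBLE `𝔽_p[G_ℚ]`-module";
Venerucci's Thm. D also assumes (Loc) — "`L(A/ℚ,1) = 0` and `res_p : H¹_f(ℚ, V_pA) → A(ℚ_p) ⊗̂ ℚ_p` is
non-zero", which "the work of Gross–Zagier–Kolyvagin guarantees … when `L(A/ℚ,s)` has a simple zero
at `s = 1`" (ibid. p. 4). The transcription below therefore ADDS `E[p]` irreducible as an explicit
hypothesis (weaker than the printed statement of Thm. 4, faithful to its proof).

## The transcription (implied by, never stronger than, the source with its inherited hypotheses)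

Tree normalisations of the SPLIT multiplicative certificates (`Record.CertSplit`,
`X2.certificate_iff_schneider_and_bsdp_of_mazurMainConjectureAt_split`, both citing Mazur–Tate–
Teitelbaum §II.10 for this very shape): THE split Mazur–Tate–Teitelbaum function `L` of a newform `f`
of `W` (`IsSplitMultPAdicLFunctionOf f p L`, `Ω⁺_f`-normalised; `ϖ·Ω(W) = Ω⁺_f`), the Tate parameter
datum `Dq` (`𝓛_p = LInvariant Dq = log_p q_E / ord_p q_E`), THE Stein–Wuthrich §4.2 split height `Dh`
(`IsSplitMultCanonical Dh Dq`: the norm-adapted Schneider = Mazur–Tate–Teitelbaum height at a split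
prime, with its `−log_p(u)²/log_p(q_E)` term; SW 2013 §4.2 p. 16, Thm. 6.1), and Miller's rational
`s = #Ш(E/ℚ)_an`. RECORDED, in valuation form (insensitive to the sign / power-of-`2` conventions of
the height): (i) `2 ≤ ord_{T=0} L`; (ii) if `Reg_p(E,Dh) ≠ 0` then `ord_{T=0} L = 2` and
`ord_p(ϖ·[T²]L·log_p(γ_cyc)²·#E(ℚ)_tors²) = ord_p(𝓛_p·∏_ℓ c_ℓ·Reg_p(E,Dh)) + ord_p s` ((ii) follows
from the printed equality since `s ≠ 0`, `ϖ ≠ 0`, `log_p γ_cyc ≠ 0`, `𝓛_p ≠ 0`). CENSUS SANITY CHECK of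
the shape (instrumentation, not an input): bsd-formula-census X11-REPORT v3 cell `r1_split`,
`(L_p″(E,𝟙)/2)/(Reg_p·Ш_an∏c/#T²) = 𝓛_p·c_∞` EXACTLY on 453/453 pairs, `ord_{T=0} = 2` on all.

## What this file provides

* `padicBSD_rankOne_splitMult_of_irreducible` (NAMED FACT, nothing asserted);
* `….order_eq_two`, `….valuation_eq` (proved projections).

References: [Disegni2020] Thm. 4 (ii), §3.2.2 (Props. 3.5–3.6), Prop. 3.2, Prop. 3.3, §1.2.1;
[Venerucci2015] §1 standing hypotheses, Thm. D, (Loc); [MazurTateTeitelbaum1986Invent] §II.10;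
[SteinWuthrich2013] §4.2, Thm. 6.1; [Miller2011LMS] Def. 1.1.
-/

noncomputable section

open scoped Classical MatrixGroups ModularForm

open CongruenceSubgroup WeierstrassCurve Literature.NumberTheory.EllipticCurves.ModularForms
  Literature.NumberTheory.EllipticCurves.SteinWuthrich2013

namespace Literature.NumberTheory.EllipticCurves.Disegni2020

/-! ### The named fact -/

/-- **Disegni 2020, Theorem 4, second clause (exact form), at analytic rank one and a SPLIT
multiplicative prime `p ≥ 5`, for irreducible `E[p]` and a second multiplicative prime.** (D. Disegni,
Kyoto J. Math. 60 (2020), Thm. 4 (ii): "if moreover there is at least another prime `m ≠ p` of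
multiplicative reduction for `E`, then [(BSD_p)] holds exactly, that is
`d² L_p(E,𝟙) = 𝓛_p(E)·R^norm(E)·L'_alg(E,1)`", with `L_p(E) ∈ (augmentation ideal)²`; proof via
Venerucci, Invent. Math. 203 (2016) Thm. D, whose standing hypotheses "`p > 3` split multiplicative"
and "`A_p` irreducible" are inherited and are made EXPLICIT hypotheses here; Venerucci's (Loc) holds at
analytic rank one by Gross–Zagier–Kolyvagin, ibid. p. 4.) TRANSCRIPTION (the cell's split certificate
shape = the Mazur–Tate–Teitelbaum form, Disegni Prop. 3.2; valuation form): for `W/ℚ` globally minimal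
elliptic, `5 ≤ p` of SPLIT multiplicative reduction, `E[p]` irreducible, some prime `ℓ ≠ p` of
multiplicative reduction, `ord_{s=1} L(E,s) = 1`, the cyclotomic `(κ, γ)` matching `T`, a newform `f`
of `W`, `ϖ` with `ϖ·Ω(W) = Ω⁺_f`, THE split Mazur–Tate–Teitelbaum function `L`, the Tate parameter datum
`Dq`, THE Stein–Wuthrich §4.2 split height `Dh`, and `s ∈ ℚ` with `#Ш(E/ℚ)_an = s`: (i)
`2 ≤ ord_{T=0} L`; (ii) if `Reg_p(E,Dh) ≠ 0` then `ord_{T=0} L = 2` and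
`ord_p(ϖ·[T²]L·log_p(γ_cyc)²·#E(ℚ)_tors²) = ord_p(𝓛_p·∏_ℓ c_ℓ·Reg_p(E,Dh)) + ord_p s`.
Named fact (D-0014): nothing is asserted; users take `(h : padicBSD_rankOne_splitMult_of_irreducible)`.
[cite: Disegni2020, Thm. 4 (ii) (§3.2) with §3.2.2 Props. 3.5–3.6, Prop. 3.2 (compatibility with MTT), Prop. 3.3]
[cite: Venerucci2015, §1 (standing hypotheses: conductor Np, p > 3 split multiplicative, A_p irreducible), Thm. D, (Loc)]
[cite: MazurTateTeitelbaum1986Invent, §II.10] [cite: SteinWuthrich2013, §4.2 and Thm. 6.1]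
[cite: Miller2011LMS, Def. 1.1] -/
def padicBSD_rankOne_splitMult_of_irreducible : Prop :=
  ∀ (W : WeierstrassCurve ℚ) [W.IsElliptic] [W.IsGloballyMinimal] (p : ℕ) [Fact p.Prime],
    5 ≤ p → W.HasSplitMultiplicativeReductionAtPrime p → W.HasIrreducibleModPGaloisRep p →
    (∃ ℓ : ℕ, ∃ _ : Fact ℓ.Prime, ℓ ≠ p ∧ W.HasMultiplicativeReductionAtPrime ℓ) →
    W.analyticRank = 1 →
    ∀ (κ : ZpExtension ℚ p) (γ : Field.absoluteGaloisGroup ℚ),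
      κ.IsCyclotomic → κ.IsTopGenerator γ → IsCyclotomicVariable p γ →
    ∀ ⦃N : ℕ⦄ [NeZero N] (f : CuspForm (Gamma0 N) 2), IsNewformOf W f →
    ∀ (ϖ : ℚ), (ϖ : ℝ) * W.realPeriodRat = plusPeriod f →
    ∀ (L : PowerSeries ℚ_[p]), IsSplitMultPAdicLFunctionOf f p L →
    ∀ (Dq : TateParameterData W p) (Dh : PAdicHeightData W p), IsSplitMultCanonical Dh Dq →
    ∀ (s : ℚ), shaAn W = (s : ℂ) →
      2 ≤ L.order ∧
      (padicRegulator Dh ≠ 0 →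
        L.order = ((2 : ℕ) : ℕ∞) ∧
        (((ϖ : ℚ) : ℚ_[p]) * PowerSeries.coeff 2 L *
            (padicLog p (cyclotomicGenerator p) ^ 2 * (W.torsionOrder : ℚ_[p]) ^ 2)).valuation =
          (LInvariant Dq * (W.tamagawaProduct : ℚ_[p]) * padicRegulator Dh).valuation +
            padicValRat p s)

/-! ### Proved projections (API) -/

namespace padicBSD_rankOne_splitMult_of_irreducible

/-- Under Schneider's non-degeneracy of THE §4.2 split height: `ord_{T=0} L_p = 2` exactly (projection
of the fact). [cite: Disegni2020, Thm. 4 (ii) (§3.2)] -/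
theorem order_eq_two (h : padicBSD_rankOne_splitMult_of_irreducible) (W : WeierstrassCurve ℚ)
    [W.IsElliptic] [W.IsGloballyMinimal] (p : ℕ) [Fact p.Prime] (hp : 5 ≤ p)
    (hsp : W.HasSplitMultiplicativeReductionAtPrime p) (hirr : W.HasIrreducibleModPGaloisRep p)
    (hℓ : ∃ ℓ : ℕ, ∃ _ : Fact ℓ.Prime, ℓ ≠ p ∧ W.HasMultiplicativeReductionAtPrime ℓ)
    (hr : W.analyticRank = 1)
    {κ : ZpExtension ℚ p} {γ : Field.absoluteGaloisGroup ℚ} (hκ : κ.IsCyclotomic)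
    (hγ : κ.IsTopGenerator γ) (hγ' : IsCyclotomicVariable p γ) {N : ℕ} [NeZero N]
    {f : CuspForm (Gamma0 N) 2} (hf : IsNewformOf W f) {ϖ : ℚ}
    (hϖ : (ϖ : ℝ) * W.realPeriodRat = plusPeriod f) {L : PowerSeries ℚ_[p]}
    (hL : IsSplitMultPAdicLFunctionOf f p L) (Dq : TateParameterData W p) {Dh : PAdicHeightData W p}
    (hDh : IsSplitMultCanonical Dh Dq) {s : ℚ} (hs : shaAn W = (s : ℂ)) (hSch : SchneiderConjecture Dh) :
    L.order = ((2 : ℕ) : ℕ∞) :=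
  ((h W p hp hsp hirr hℓ hr κ γ hκ hγ hγ' f hf ϖ hϖ L hL Dq Dh hDh s hs).2 hSch).1

/-- Under Schneider's non-degeneracy of THE §4.2 split height: the rank-one exceptional-zero
leading-term identity in valuations (projection of the fact). [cite: Disegni2020, Thm. 4 (ii) (§3.2)] -/
theorem valuation_eq (h : padicBSD_rankOne_splitMult_of_irreducible) (W : WeierstrassCurve ℚ)
    [W.IsElliptic] [W.IsGloballyMinimal] (p : ℕ) [Fact p.Prime] (hp : 5 ≤ p)
    (hsp : W.HasSplitMultiplicativeReductionAtPrime p) (hirr : W.HasIrreducibleModPGaloisRep p)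
    (hℓ : ∃ ℓ : ℕ, ∃ _ : Fact ℓ.Prime, ℓ ≠ p ∧ W.HasMultiplicativeReductionAtPrime ℓ)
    (hr : W.analyticRank = 1)
    {κ : ZpExtension ℚ p} {γ : Field.absoluteGaloisGroup ℚ} (hκ : κ.IsCyclotomic)
    (hγ : κ.IsTopGenerator γ) (hγ' : IsCyclotomicVariable p γ) {N : ℕ} [NeZero N]
    {f : CuspForm (Gamma0 N) 2} (hf : IsNewformOf W f) {ϖ : ℚ}
    (hϖ : (ϖ : ℝ) * W.realPeriodRat = plusPeriod f) {L : PowerSeries ℚ_[p]}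
    (hL : IsSplitMultPAdicLFunctionOf f p L) (Dq : TateParameterData W p) {Dh : PAdicHeightData W p}
    (hDh : IsSplitMultCanonical Dh Dq) {s : ℚ} (hs : shaAn W = (s : ℂ)) (hSch : SchneiderConjecture Dh) :
    (((ϖ : ℚ) : ℚ_[p]) * PowerSeries.coeff 2 L *
        (padicLog p (cyclotomicGenerator p) ^ 2 * (W.torsionOrder : ℚ_[p]) ^ 2)).valuation =
      (LInvariant Dq * (W.tamagawaProduct : ℚ_[p]) * padicRegulator Dh).valuation + padicValRat p s :=
  ((h W p hp hsp hirr hℓ hr κ γ hκ hγ hγ' f hf ϖ hϖ L hL Dq Dh hDh s hs).2 hSch).2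

end padicBSD_rankOne_splitMult_of_irreducible

end Literature.NumberTheory.EllipticCurves.Disegni2020

end
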